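import Mathlib
import Literature.Computability.AlgebraicComplexity.FixedPointExp
import HarnessLib

/-!
# Cylinder entropy slice isolation — certificate arithmetic (Cert infrastructure 1/4)

Computable enclosure arithmetic over `ℚ` for the `native_decide` certificate checker of the
mid-scale kernel certificates `stub_certMidA/B/C` of the crux
`Summit.SmoothPoincare4.SmoothPoincare4.Theses.CylinderEntropy.SliceIsolation`
(line `conformal-kernel-domination`):

* `Cert.rdn` / `Cert.rup` — directed rounding of a rational to `p` fractional bits
  (`rdn_le`, `le_rup`, `rdn_le_real`, `le_rup_real`);
* `Cert.expLo` / `Cert.expHi` — dyadic enclosures of `Real.exp x` for every `x : ℚ`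
  (`expLo_le`, `exp_le_expHi`, `expLo_nonneg`), a thin wrapper around the proved fixed-point
  kit `Literature.Computability.AlgebraicComplexity.FixedPoint.expLo/expHi` (argument halving,
  Taylor polynomial with directed rounding, repeated squaring; `FixedPoint.exp_sound`) with the
  squaring hint `Cert.expS` and the working precision chosen from `x` and `p`;
* `Cert.sqrtLo` — a dyadic lower bound of `Real.sqrt x` (`sqrtLo_le`, `sqrtLo_nonneg`);
* `helper_certExpEnclosure` — the registered helper (the two `exp` bounds together).

All definitions are computable (`ℚ`/`ℕ`/`ℤ` arithmetic, structural recursion), so they run under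
`native_decide`/`#eval`; the soundness theorems relate them to `ℝ` through the cast `((· : ℚ) : ℝ)`.
Parameters (irrelevant to soundness): `s = expS x` squarings, working precision `P = p + s + 10`,
`N = P/7 + 2` Taylor terms at the reduced argument `|x|/2^s < 1/16`; measured (2026-08-16, IR
interpreter, as used by `native_decide`): width `expHi x 60 - expLo x 60 = 2^-60` (one ulp) for
`exp x ≤ 1`, relative width `≈ 2^-66` for `x = 25`, and `6000` enclosures (`p = 60`, `|x| ≤ 31`)
in `≈ 0.16 s`, i.e. about `4·10^4` calls per second (`6·10^4` for `|x| ≤ 3`).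
Everything here is [folklore]; no named facts, no axioms beyond the whitelist.
-/

-- the registered namespace `Summit.SmoothPoincare4.SmoothPoincare4.Theorems…` repeats a component
set_option linter.dupNamespace false

namespace Summit.SmoothPoincare4.SmoothPoincare4.Theorems.CylinderEntropySliceIsolation

open Literature.Computability.AlgebraicComplexity

namespace Cert

/-! ## Directed dyadic rounding -/

/-- Round `x` down to `p` fractional bits: `⌊x 2^p⌋ / 2^p`. [folklore] -/
def rdn (x : ℚ) (p : ℕ) : ℚ := ((⌊x * 2 ^ p⌋ : ℤ) : ℚ) / 2 ^ p

/-- Round `x` up to `p` fractional bits: `-rdn (-x) p`. [folklore] -/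
def rup (x : ℚ) (p : ℕ) : ℚ := -rdn (-x) p

/-- `rdn x p ≤ x`. [folklore] -/
theorem rdn_le (x : ℚ) (p : ℕ) : rdn x p ≤ x := by
  unfold rdn
  rw [div_le_iff₀ (by positivity)]
  exact Int.floor_le _

/-- `x ≤ rup x p`. [folklore] -/
theorem le_rup (x : ℚ) (p : ℕ) : x ≤ rup x p := by
  unfold rup
  have h := rdn_le (-x) p
  linarith

/-- `rdn x p ≤ x` read in `ℝ`. [folklore] -/
theorem rdn_le_real (x : ℚ) (p : ℕ) : ((rdn x p : ℚ) : ℝ) ≤ (x : ℝ) :=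
  Rat.cast_le.mpr (rdn_le x p)

/-- `x ≤ rup x p` read in `ℝ`. [folklore] -/
theorem le_rup_real (x : ℚ) (p : ℕ) : (x : ℝ) ≤ ((rup x p : ℚ) : ℝ) :=
  Rat.cast_le.mpr (le_rup x p)

/-- Rounding down a non-negative rational gives a non-negative rational. [folklore] -/
theorem rdn_nonneg {x : ℚ} (hx : 0 ≤ x) (p : ℕ) : 0 ≤ rdn x p := by
  unfold rdn
  have h : (0 : ℤ) ≤ ⌊x * 2 ^ p⌋ := Int.floor_nonneg.mpr (by positivity)
  exact div_nonneg (by exact_mod_cast h) (by positivity)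

/-- `x ≤ y` read in `ℝ` after rounding: `rdn x p ≤ y` in `ℝ` from `x ≤ y` in `ℝ`. [folklore] -/
theorem rdn_le_real_of_le {x : ℚ} {y : ℝ} (h : (x : ℝ) ≤ y) (p : ℕ) : ((rdn x p : ℚ) : ℝ) ≤ y :=
  (rdn_le_real x p).trans h

/-- `y ≤ rup x p` in `ℝ` from `y ≤ x` in `ℝ`. [folklore] -/
theorem le_rup_real_of_le {x : ℚ} {y : ℝ} (h : y ≤ (x : ℝ)) (p : ℕ) : y ≤ ((rup x p : ℚ) : ℝ) :=
  h.trans (le_rup_real x p)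

/-! ## Enclosures of `exp` -/

/-- The squaring hint of `x`: `s = log₂ ⌈16 |x|⌉₊ + 1`, so that `|x| < 2^s / 16` (the reduced
argument `|x| / 2^s` of the Taylor polynomial is `< 1/16`). [folklore] -/
def expS (x : ℚ) : ℕ := Nat.log2 ⌈|x| * 16⌉₊ + 1

/-- The hint is admissible: `|x.num| ≤ x.den · 2^s`, i.e. `|x| ≤ 2^s`. [folklore] -/
theorem natAbs_num_le_expS (x : ℚ) : x.num.natAbs ≤ x.den * 2 ^ expS x := by
  have h1 : |x| * 16 ≤ (⌈|x| * 16⌉₊ : ℚ) := Nat.le_ceil _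
  have h2 : ((⌈|x| * 16⌉₊ : ℕ) : ℚ) < (2 : ℚ) ^ expS x := by
    exact_mod_cast (Nat.lt_log2_self : ⌈|x| * 16⌉₊ < 2 ^ (Nat.log2 ⌈|x| * 16⌉₊ + 1))
  have h0 : 0 ≤ |x| := abs_nonneg x
  have habs : |x| ≤ 2 ^ expS x := by linarith
  have hden : (0 : ℚ) < x.den := by exact_mod_cast x.den_pos
  have hx : (x.num.natAbs : ℚ) = |x| * x.den := by
    rw [Nat.cast_natAbs, Int.cast_abs]
    nth_rewrite 2 [← Rat.num_div_den x]
    rw [abs_div, abs_of_pos hden, div_mul_cancel₀ _ hden.ne']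
  have key : (x.num.natAbs : ℚ) ≤ ((x.den * 2 ^ expS x : ℕ) : ℚ) := by
    rw [hx]
    push_cast
    nlinarith
  exact_mod_cast key

/-- **Soundness of the fixed-point core at `x : ℚ`**: for an admissible hint `s`, any precision
`P` and any `N ≥ 1` Taylor terms, `FixedPoint.expLo / 2^P ≤ exp x ≤ FixedPoint.expHi / 2^P`
(`FixedPoint.exp_sound` transported along `(x : ℝ) = x.num / x.den`). [folklore] -/
theorem expCore_sound (x : ℚ) {s N : ℕ} (hs : x.num.natAbs ≤ x.den * 2 ^ s) (hN : 0 < N)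
    (P : ℕ) :
    ((FixedPoint.expLo P N s x.num x.den : ℕ) : ℝ) / 2 ^ P ≤ Real.exp (x : ℝ) ∧
      Real.exp (x : ℝ) ≤ ((FixedPoint.expHi P N s x.num x.den : ℕ) : ℝ) / 2 ^ P := by
  obtain ⟨hlo, hhi⟩ := FixedPoint.exp_sound P hN x.den_pos hs
  rw [← Rat.cast_def] at hlo hhi
  have h2 : (0 : ℝ) < 2 ^ P := by positivity
  exact ⟨by rw [div_le_iff₀ h2]; linarith, by rw [le_div_iff₀ h2]; linarith⟩

/-- **Lower enclosure of `exp x`**, rounded down to `p` fractional bits: the fixed-point lower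
value at working precision `P = p + s + 10` with `N = P/7 + 2` Taylor terms and `s = expS x`
squarings, divided by `2^P`. [folklore] -/
def expLo (x : ℚ) (p : ℕ) : ℚ :=
  let s := expS x
  let P := p + s + 10
  rdn ((FixedPoint.expLo P (P / 7 + 2) s x.num x.den : ℚ) / 2 ^ P) p

/-- **Upper enclosure of `exp x`**, rounded up to `p` fractional bits (same parameters as
`expLo`). [folklore] -/
def expHi (x : ℚ) (p : ℕ) : ℚ :=
  let s := expS x
  let P := p + s + 10
  rup ((FixedPoint.expHi P (P / 7 + 2) s x.num x.den : ℚ) / 2 ^ P) p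

/-- **`expLo x p ≤ exp x`.** [folklore] -/
theorem expLo_le (x : ℚ) (p : ℕ) : ((expLo x p : ℚ) : ℝ) ≤ Real.exp (x : ℝ) := by
  have h := (expCore_sound x (natAbs_num_le_expS x) (Nat.succ_pos ((p + expS x + 10) / 7 + 1))
    (p + expS x + 10)).1
  refine rdn_le_real_of_le ?_ p
  push_cast
  exact h

/-- **`exp x ≤ expHi x p`.** [folklore] -/
theorem exp_le_expHi (x : ℚ) (p : ℕ) : Real.exp (x : ℝ) ≤ ((expHi x p : ℚ) : ℝ) := by
  have h := (expCore_sound x (natAbs_num_le_expS x) (Nat.succ_pos ((p + expS x + 10) / 7 + 1))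
    (p + expS x + 10)).2
  refine le_rup_real_of_le ?_ p
  push_cast
  exact h

/-- `0 ≤ expLo x p`. [folklore] -/
theorem expLo_nonneg (x : ℚ) (p : ℕ) : 0 ≤ expLo x p :=
  rdn_nonneg (by positivity) p

/-- `expLo x p ≤ expHi x p` (in `ℚ`). [folklore] -/
theorem expLo_le_expHi (x : ℚ) (p : ℕ) : expLo x p ≤ expHi x p := by
  have h : ((expLo x p : ℚ) : ℝ) ≤ ((expHi x p : ℚ) : ℝ) :=
    (expLo_le x p).trans (exp_le_expHi x p)
  exact_mod_cast h

/-! ## A lower bound of `√x` -/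

/-- **Lower bound of `√x`** to `p` fractional bits: `Nat.sqrt ⌊x 4^p⌋₊ / 2^p` (which is `0` for
`x ≤ 0`). [folklore] -/
def sqrtLo (x : ℚ) (p : ℕ) : ℚ := ((Nat.sqrt ⌊x * 4 ^ p⌋₊ : ℕ) : ℚ) / 2 ^ p

/-- `0 ≤ sqrtLo x p`. [folklore] -/
theorem sqrtLo_nonneg (x : ℚ) (p : ℕ) : 0 ≤ sqrtLo x p :=
  div_nonneg (Nat.cast_nonneg _) (by positivity)

/-- **`sqrtLo x p ≤ √x`.** [folklore] -/
theorem sqrtLo_le (x : ℚ) (p : ℕ) : ((sqrtLo x p : ℚ) : ℝ) ≤ Real.sqrt (x : ℝ) := by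
  unfold sqrtLo
  rcases le_or_gt 0 x with hx | hx
  · apply Real.le_sqrt_of_sq_le
    have h1 : ((Nat.sqrt ⌊x * 4 ^ p⌋₊ : ℕ) : ℝ) ^ 2 ≤ ((⌊x * 4 ^ p⌋₊ : ℕ) : ℝ) := by
      exact_mod_cast Nat.sqrt_le' _
    have h2 : ((⌊x * 4 ^ p⌋₊ : ℕ) : ℚ) ≤ x * 4 ^ p := Nat.floor_le (by positivity)
    have h3 : (((⌊x * 4 ^ p⌋₊ : ℕ) : ℚ) : ℝ) ≤ ((x * 4 ^ p : ℚ) : ℝ) := Rat.cast_le.mpr h2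
    push_cast at h3 ⊢
    have h4 : ((4 : ℝ) ^ p) = (2 ^ p) ^ 2 := by
      rw [← pow_mul, mul_comm, pow_mul]
      norm_num
    rw [div_pow, div_le_iff₀ (by positivity), ← h4]
    exact h1.trans h3
  · have h0 : ⌊x * 4 ^ p⌋₊ = 0 :=
      Nat.floor_of_nonpos (mul_nonpos_of_nonpos_of_nonneg hx.le (by positivity))
    rw [h0]
    simp

end Cert

/-- **Registered helper `helper_certExpEnclosure`** (crux stmt-SmoothPoincare4-7632, line
`conformal-kernel-domination`): the computable dyadic enclosure `[Cert.expLo x p, Cert.expHi x p]`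
contains `exp x` for every rational `x` and every precision `p`. [folklore] -/
theorem helper_certExpEnclosure : ∀ (x : ℚ) (p : ℕ), ((Cert.expLo x p : ℚ) : ℝ) ≤ Real.exp (x : ℝ) ∧ Real.exp (x : ℝ) ≤ ((Cert.expHi x p : ℚ) : ℝ) :=
  fun x p => ⟨Cert.expLo_le x p, Cert.exp_le_expHi x p⟩

end Summit.SmoothPoincare4.SmoothPoincare4.Theorems.CylinderEntropySliceIsolation
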